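import Summits.QuantumFields.BalabanUV.Beta.EriceRemainderEnclosureHistoryAutonomyComparisonTowerChainFourLemmas

/-!
# EriceRemainderEnclosureHistoryAutonomyComparisonTowerFreeSteps — (E67a) THE FREE FIRST STEP AND THE FREE LAST STEP: a tower whose consecutive ratios are `≥ 4`
# EXCEPT possibly the first (youngest pair) and the last (oldest pair) still closes the dual chain of (E65e)∕(E65f).  This file supplies the two step lemmas
# for an ARBITRARY ratio `k⁻∕k = r ∈ [1∕4, 1]` under the crude budget line `x√(1∕2) + y√(r∕(1+r)) ≤ 1∕2` ((E65h) form): **`first_step_free`** — from the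
# EXACT youngest state (`λ₀ = σ₀ = y∕(1 − 3y∕4)`, `μ₀ = 3σ₀∕4`, defect `e ≤ a·μ₀ = 3rσ₀∕(1+r)²`, the one-step transport of (E65c)) the step lands inside the
# hyperbolic invariant region of (E66b): `λ ≤ 4Z∕(2 − Z)`, `Z = x + √r·y`, with the chain condition; **`last_step_free`** — from the invariant region
# (`λ_{k⁻} ≤ 4Z∕(2 − Z)`, `Z ≤ 71∕100`) the chain CONDITION `x(3∕4 + 2rλ_{k⁻}) < 1` holds at the last age for every `r ∈ [1∕4, 1]` (value `≤ 0.93`).  Both by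
# splitting `r` into intervals (6 and 3) on which the irrational data `√r`, `√(r∕(1+r))`, `3r∕(1+r)²` are replaced by rational endpoints, leaving cubic ∕
# bilinear inequalities in two variables with exact Handelman certificates (`nlinarith` hints = the certificates' products).  With (E67b)∕(E67c): every
# finite age set with `#A ≤ 3` compares, whatever the ratios ((T3) of the census READMEs — three ages COMPLETE)

Cell `pub-balaban`, β-function sub-cell, BINDER row D4 «RemainderConst leaves for Bałaban's split» (`HOME/BINDER-OWNERS.md`; owner lineage `b2b-balaban-beta-an4`;
this file by co-owner #2 lineage `b2b-balaban-beta-d4-p2`, generation 59), β-FLOW TEAM duty (1), FREEZE (0) honoured (def-free; Mathlib only in substance).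

HONEST FRAMING (page 1, verbatim and binding).  *"Discharging BetaPertH makes Bałaban's UV stability UNCONDITIONAL — a real constructive-QFT result; it is
NOT the continuum limit and NOT the Clay problem."*  THIS FILE DISCHARGES NOTHING OF THE KIND.  Lemmas about a few non-negative reals; their use is through
(E65f), whose hypotheses are those of a census, not facts; nothing of Bałaban's is asserted.  Row D4 class UNCHANGED (critical-path width 0; instance 0∕1;
D4 DISCHARGE NO DATE).  HONEST DEPENDENCY: continuum YM on T⁴ ⇐ BetaPertH ∧ nine spine estimates (0/9 proved); BetaPertH ⇐ (D1) ∧ (D4) ∧ CAP+tail;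
G-an2-4 gates asym, D1 and NE2/3/4.

THE POINT (census sense (α); the COMPARISON column, conjecture (E58′), route (C″) and target (T3)).  Numerics (README `freesteps.py`, `intervals.py`,
`handel_free.py`): from the exact youngest state a step of ANY ratio lands in `λ ≤ 4Z∕(2 − Z)` with normalized margin `0.23` (the μ-transport `a·μ₀`,
not `2rλ₀`, is what makes ratios near `1` harmless); from the region the last condition value is `≤ 0.88` (`0.93` with the interval constants).  NOT CLAIMED:
a free step in the MIDDLE of a tower (the state leaves the region); anything printed.

WHAT IS PROVED ([folklore]; 0 `def`, 0 sorry).  §1 `first_poly_1` … `first_poly_6`, `first_cond_poly`, `last_poly_1` … `last_poly_3` (certified polynomial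
inequalities).  §2 `le_sqrt_ratio`, `hyperbola_mono`, **`first_step_free`**, **`last_step_free`**.
-/
noncomputable section
open Finset

namespace Summit.QuantumFields.BalabanUV.Beta.EriceRemainderEnclosureHistoryAutonomyComparisonTowerFreeSteps

/-! ## §1 The certified polynomial inequalities on the six + three ratio intervals -/

/-- Free first step, ratio interval `√r ∈ [1 / 2, 27 / 50]`: the landing inequality `λ₂ ≤ 4Z₂∕(2 − Z₂)` with denominators cleared, rational endpoint data
(`credit ≥ 447 / 1000`, `r ≤ 729 / 2500`, `3r∕(1+r)² ≤ 1311 / 2500`, `√r ≥ 1 / 2`); `nlinarith` hints = an exact degree-3 Handelman certificate. [folklore] -/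
theorem first_poly_1 {x y : ℝ} (hx : 0 ≤ x) (hy : 0 ≤ y) (hy1 : y ≤ 71 / 100) (hb : 70 / 99 * x + 447 / 1000 * y ≤ 1 / 2) :
    (y * (729 / 2500) * (1 + x / 4) + x * ((1 - 3 / 4 * y) + 1311 / 2500 * y)) * (2 - x - 1 / 2 * y) ≤
      4 * (x + 1 / 2 * y) * ((1 - 3 / 4 * y) * (1 - 3 / 4 * x) - 1311 / 2500 * y * x) := by
  have hb' : 0 ≤ 1 / 2 - 70 / 99 * x - 447 / 1000 * y := by linarith
  have hy' : 0 ≤ 71 / 100 - y := by linarith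
  nlinarith [mul_nonneg hy hy', mul_nonneg hy hb', mul_nonneg (mul_nonneg hy hb') hy', mul_nonneg (mul_nonneg hy hy) hy',
    mul_nonneg hx hy', mul_nonneg hx hb', mul_nonneg (mul_nonneg hx hy) hb', mul_nonneg hy hy, mul_nonneg (mul_nonneg hx hy) hy, mul_nonneg hx hx]

/-- Free first step, ratio interval `√r ∈ [27 / 50, 59 / 100]`: the landing inequality `λ₂ ≤ 4Z₂∕(2 − Z₂)` with denominators cleared, rational endpoint data
(`credit ≥ 19 / 40`, `r ≤ 3481 / 10000`, `3r∕(1+r)² ≤ 5747 / 10000`, `√r ≥ 27 / 50`); `nlinarith` hints = an exact degree-3 Handelman certificate. [folklore] -/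
theorem first_poly_2 {x y : ℝ} (hx : 0 ≤ x) (hy : 0 ≤ y) (hy1 : y ≤ 71 / 100) (hb : 70 / 99 * x + 19 / 40 * y ≤ 1 / 2) :
    (y * (3481 / 10000) * (1 + x / 4) + x * ((1 - 3 / 4 * y) + 5747 / 10000 * y)) * (2 - x - 27 / 50 * y) ≤
      4 * (x + 27 / 50 * y) * ((1 - 3 / 4 * y) * (1 - 3 / 4 * x) - 5747 / 10000 * y * x) := by
  have hb' : 0 ≤ 1 / 2 - 70 / 99 * x - 19 / 40 * y := by linarith
  have hy' : 0 ≤ 71 / 100 - y := by linarith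
  nlinarith [mul_nonneg hy hy', mul_nonneg hy hb', mul_nonneg (mul_nonneg hy hb') hy', mul_nonneg (mul_nonneg hy hy) hy',
    mul_nonneg hx hy', mul_nonneg hx hb', mul_nonneg (mul_nonneg hx hy) hb', mul_nonneg hy hy, mul_nonneg (mul_nonneg hx hy) hy, mul_nonneg hx hx]

/-- Free first step, ratio interval `√r ∈ [59 / 100, 13 / 20]`: the landing inequality `λ₂ ≤ 4Z₂∕(2 − Z₂)` with denominators cleared, rational endpoint data
(`credit ≥ 127 / 250`, `r ≤ 169 / 400`, `3r∕(1+r)² ≤ 783 / 1250`, `√r ≥ 59 / 100`); `nlinarith` hints = an exact degree-3 Handelman certificate. [folklore] -/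
theorem first_poly_3 {x y : ℝ} (hx : 0 ≤ x) (hy : 0 ≤ y) (hy1 : y ≤ 71 / 100) (hb : 70 / 99 * x + 127 / 250 * y ≤ 1 / 2) :
    (y * (169 / 400) * (1 + x / 4) + x * ((1 - 3 / 4 * y) + 783 / 1250 * y)) * (2 - x - 59 / 100 * y) ≤
      4 * (x + 59 / 100 * y) * ((1 - 3 / 4 * y) * (1 - 3 / 4 * x) - 783 / 1250 * y * x) := by
  have hb' : 0 ≤ 1 / 2 - 70 / 99 * x - 127 / 250 * y := by linarith
  have hy' : 0 ≤ 71 / 100 - y := by linarith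
  nlinarith [mul_nonneg hy hy', mul_nonneg hy hb', mul_nonneg (mul_nonneg hy hb') hy', mul_nonneg (mul_nonneg hy hy) hy',
    mul_nonneg hx hy', mul_nonneg hx hb', mul_nonneg (mul_nonneg hx hy) hb', mul_nonneg hy hy, mul_nonneg (mul_nonneg hx hy) hy, mul_nonneg hx hx]

/-- Free first step, ratio interval `√r ∈ [13 / 20, 37 / 50]`: the landing inequality `λ₂ ≤ 4Z₂∕(2 − Z₂)` with denominators cleared, rational endpoint data
(`credit ≥ 68 / 125`, `r ≤ 1369 / 2500`, `3r∕(1+r)² ≤ 343 / 500`, `√r ≥ 13 / 20`); `nlinarith` hints = an exact degree-3 Handelman certificate. [folklore] -/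
theorem first_poly_4 {x y : ℝ} (hx : 0 ≤ x) (hy : 0 ≤ y) (hy1 : y ≤ 71 / 100) (hb : 70 / 99 * x + 68 / 125 * y ≤ 1 / 2) :
    (y * (1369 / 2500) * (1 + x / 4) + x * ((1 - 3 / 4 * y) + 343 / 500 * y)) * (2 - x - 13 / 20 * y) ≤
      4 * (x + 13 / 20 * y) * ((1 - 3 / 4 * y) * (1 - 3 / 4 * x) - 343 / 500 * y * x) := by
  have hb' : 0 ≤ 1 / 2 - 70 / 99 * x - 68 / 125 * y := by linarith
  have hy' : 0 ≤ 71 / 100 - y := by linarith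
  nlinarith [mul_nonneg hy hy', mul_nonneg hy hb', mul_nonneg (mul_nonneg hy hb') hy', mul_nonneg (mul_nonneg hy hy) hy',
    mul_nonneg hx hy', mul_nonneg hx hb', mul_nonneg (mul_nonneg hx hy) hb', mul_nonneg hy hy, mul_nonneg (mul_nonneg hx hy) hy, mul_nonneg hx hx]

/-- Free first step, ratio interval `√r ∈ [37 / 50, 43 / 50]`: the landing inequality `λ₂ ≤ 4Z₂∕(2 − Z₂)` with denominators cleared, rational endpoint data
(`credit ≥ 297 / 500`, `r ≤ 1849 / 2500`, `3r∕(1+r)² ≤ 7333 / 10000`, `√r ≥ 37 / 50`); `nlinarith` hints = an exact degree-3 Handelman certificate. [folklore] -/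
theorem first_poly_5 {x y : ℝ} (hx : 0 ≤ x) (hy : 0 ≤ y) (hy1 : y ≤ 71 / 100) (hb : 70 / 99 * x + 297 / 500 * y ≤ 1 / 2) :
    (y * (1849 / 2500) * (1 + x / 4) + x * ((1 - 3 / 4 * y) + 7333 / 10000 * y)) * (2 - x - 37 / 50 * y) ≤
      4 * (x + 37 / 50 * y) * ((1 - 3 / 4 * y) * (1 - 3 / 4 * x) - 7333 / 10000 * y * x) := by
  have hb' : 0 ≤ 1 / 2 - 70 / 99 * x - 297 / 500 * y := by linarith
  have hy' : 0 ≤ 71 / 100 - y := by linarith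
  nlinarith [mul_nonneg hy hy', mul_nonneg hy hb', mul_nonneg (mul_nonneg hy hb') hy', mul_nonneg (mul_nonneg hy hy) hy',
    mul_nonneg hx hy', mul_nonneg hx hb', mul_nonneg (mul_nonneg hx hy) hb', mul_nonneg hy hy, mul_nonneg (mul_nonneg hx hy) hy, mul_nonneg hx hx]

/-- Free first step, ratio interval `√r ∈ [43 / 50, 1]`: the landing inequality `λ₂ ≤ 4Z₂∕(2 − Z₂)` with denominators cleared, rational endpoint data
(`credit ≥ 163 / 250`, `r ≤ 1`, `3r∕(1+r)² ≤ 3 / 4`, `√r ≥ 43 / 50`); `nlinarith` hints = an exact degree-3 Handelman certificate. [folklore] -/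
theorem first_poly_6 {x y : ℝ} (hx : 0 ≤ x) (hy : 0 ≤ y) (hy1 : y ≤ 71 / 100) (hb : 70 / 99 * x + 163 / 250 * y ≤ 1 / 2) :
    (y * (1) * (1 + x / 4) + x * ((1 - 3 / 4 * y) + 3 / 4 * y)) * (2 - x - 43 / 50 * y) ≤
      4 * (x + 43 / 50 * y) * ((1 - 3 / 4 * y) * (1 - 3 / 4 * x) - 3 / 4 * y * x) := by
  have hb' : 0 ≤ 1 / 2 - 70 / 99 * x - 163 / 250 * y := by linarith
  have hy' : 0 ≤ 71 / 100 - y := by linarith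
  nlinarith [mul_nonneg hy hy', mul_nonneg hy hb', mul_nonneg (mul_nonneg hy hb') hy', mul_nonneg (mul_nonneg hy hy) hy',
    mul_nonneg hx hy', mul_nonneg hx hb', mul_nonneg (mul_nonneg hx hy) hb', mul_nonneg hy hy, mul_nonneg (mul_nonneg hx hy) hy, mul_nonneg hx hx]

/-- Free first step, the chain condition with denominators cleared (worst constants: credit `≥ 0.447`, `3r∕(1+r)² ≤ 3∕4`). [folklore] -/
theorem first_cond_poly {x y : ℝ} (hx : 0 ≤ x) (hy1 : y ≤ 71 / 100) (hb : 70 / 99 * x + 447 / 1000 * y ≤ 1 / 2) :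
    x * (3 / 4 * (1 - 3 / 4 * y) + 3 / 4 * y) < 1 - 3 / 4 * y := by
  nlinarith [mul_nonneg hx (sub_nonneg.mpr hy1), mul_nonneg hx (sub_nonneg.mpr hb)]

/-- Free last step, ratio interval `√r ∈ [1 / 2, 3 / 4]`: the condition `x(3∕4 + 8rZ∕(2 − Z)) < 1` with the denominator cleared (`credit ≥ 447 / 1000`, `r ≤ 9 / 16`);
split at `Z = 3∕10`, each half an exact Handelman certificate. [folklore] -/
theorem last_poly_1 {x z : ℝ} (hz : 0 ≤ z) (hz1 : z ≤ 71 / 100) (hb : 70 / 99 * x + 447 / 1000 * z ≤ 1 / 2) :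
    x * (3 / 4 * (2 - z) + 8 * (9 / 16) * z) < 2 - z := by
  have hb' : 0 ≤ 1 / 2 - 70 / 99 * x - 447 / 1000 * z := by linarith
  have hz' : 0 ≤ 71 / 100 - z := by linarith
  rcases le_or_gt z (3 / 10) with h | h
  · have h1 : 0 ≤ 3 / 10 - z := by linarith
    nlinarith [hb', h1, mul_nonneg h1 h1, mul_nonneg hz hb', mul_nonneg hz' hz']
  · have h0 : 0 ≤ z - 3 / 10 := by linarith
    nlinarith [hb', mul_nonneg hz' hz', mul_nonneg (mul_nonneg hz' hz') hz', mul_nonneg h0 hb', mul_nonneg h0 h0, mul_nonneg (mul_nonneg h0 h0) h0]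

/-- Free last step, ratio interval `√r ∈ [3 / 4, 22 / 25]`: the condition `x(3∕4 + 8rZ∕(2 − Z)) < 1` with the denominator cleared (`credit ≥ 3 / 5`, `r ≤ 484 / 625`);
split at `Z = 3∕10`, each half an exact Handelman certificate. [folklore] -/
theorem last_poly_2 {x z : ℝ} (hz : 0 ≤ z) (hz1 : z ≤ 71 / 100) (hb : 70 / 99 * x + 3 / 5 * z ≤ 1 / 2) :
    x * (3 / 4 * (2 - z) + 8 * (484 / 625) * z) < 2 - z := by
  have hb' : 0 ≤ 1 / 2 - 70 / 99 * x - 3 / 5 * z := by linarith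
  have hz' : 0 ≤ 71 / 100 - z := by linarith
  rcases le_or_gt z (3 / 10) with h | h
  · have h1 : 0 ≤ 3 / 10 - z := by linarith
    nlinarith [hb', h1, mul_nonneg h1 h1, mul_nonneg hz hb', mul_nonneg hz' hz']
  · have h0 : 0 ≤ z - 3 / 10 := by linarith
    nlinarith [hb', mul_nonneg hz' hz', mul_nonneg (mul_nonneg hz' hz') hz', mul_nonneg h0 hb', mul_nonneg h0 h0, mul_nonneg (mul_nonneg h0 h0) h0]

/-- Free last step, ratio interval `√r ∈ [22 / 25, 1]`: the condition `x(3∕4 + 8rZ∕(2 − Z)) < 1` with the denominator cleared (`credit ≥ 33 / 50`, `r ≤ 1`);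
split at `Z = 3∕10`, each half an exact Handelman certificate. [folklore] -/
theorem last_poly_3 {x z : ℝ} (hz : 0 ≤ z) (hz1 : z ≤ 71 / 100) (hb : 70 / 99 * x + 33 / 50 * z ≤ 1 / 2) :
    x * (3 / 4 * (2 - z) + 8 * (1) * z) < 2 - z := by
  have hb' : 0 ≤ 1 / 2 - 70 / 99 * x - 33 / 50 * z := by linarith
  have hz' : 0 ≤ 71 / 100 - z := by linarith
  rcases le_or_gt z (3 / 10) with h | h
  · have h1 : 0 ≤ 3 / 10 - z := by linarith
    nlinarith [hb', h1, mul_nonneg h1 h1, mul_nonneg hz hb', mul_nonneg hz' hz']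
  · have h0 : 0 ≤ z - 3 / 10 := by linarith
    nlinarith [hb', mul_nonneg hz' hz', mul_nonneg (mul_nonneg hz' hz') hz', mul_nonneg h0 hb', mul_nonneg h0 h0, mul_nonneg (mul_nonneg h0 h0) h0]

/-! ## §2 The two free steps -/

/-- `c ≤ √(r∕(1+r))` as soon as `c ≥ 0` and `c²(1 + r) ≤ r`. [folklore] -/
theorem le_sqrt_ratio {c r : ℝ} (hc : 0 ≤ c) (hr : 0 ≤ r) (h : c ^ 2 * (1 + r) ≤ r) : c ≤ Real.sqrt (r / (1 + r)) := by
  rw [show c = Real.sqrt (c ^ 2) by rw [Real.sqrt_sq hc]]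
  exact Real.sqrt_le_sqrt (by rw [le_div_iff₀ (by linarith)]; exact h)

/-- The hyperbola `Z ↦ 4Z∕(2 − Z)` is monotone on `[0, 2[`. [folklore] -/
theorem hyperbola_mono {a b : ℝ} (hab : a ≤ b) (hb : b < 2) : 4 * a / (2 - a) ≤ 4 * b / (2 - b) := by
  rw [div_le_div_iff₀ (by linarith) (by linarith)]; nlinarith

set_option maxHeartbeats 400000 in
/-- From the rational-endpoint data of one ratio interval to the two free-first-step conclusions. -/
theorem first_of_interval {x y r S R c E : ℝ} (hx : 0 ≤ x) (hy : 0 ≤ y) (hy1 : y ≤ 71 / 100) (hr0 : 0 ≤ r) (hr1 : r ≤ 1)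
    (hS : 0 ≤ S) (hS1 : S ≤ 1) (hSr : S ^ 2 ≤ r) (hrR : r ≤ R) (hR1 : R ≤ 1) (hc : 447 / 1000 ≤ c) (hcr : c ^ 2 * (1 + r) ≤ r)
    (hE : 3 * R ≤ E * (1 + R) ^ 2) (hE1 : E ≤ 3 / 4)
    (hb : x * Real.sqrt (1 / 2) + y * Real.sqrt (r / (1 + r)) ≤ 1 / 2)
    (hpoly : 70 / 99 * x + c * y ≤ 1 / 2 →
      (y * R * (1 + x / 4) + x * ((1 - 3 / 4 * y) + E * y)) * (2 - x - S * y) ≤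
        4 * (x + S * y) * ((1 - 3 / 4 * y) * (1 - 3 / 4 * x) - E * y * x)) :
    x * (3 * r / (1 + r) ^ 2 * (y / (1 - 3 / 4 * y)) + 3 / 4) < 1 ∧
    y / (1 - 3 / 4 * y) * r * (1 + x / 4) + x * (1 + 3 * r / (1 + r) ^ 2 * (y / (1 - 3 / 4 * y))) ≤
      4 * (x + Real.sqrt r * y) / (2 - (x + Real.sqrt r * y)) * (1 - x * (3 / 4 + 3 * r / (1 + r) ^ 2 * (y / (1 - 3 / 4 * y)))) := by
  have h70 : (70 : ℝ) / 99 ≤ Real.sqrt (1 / 2) := by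
    rw [show (70 : ℝ) / 99 = Real.sqrt ((70 / 99) ^ 2) by rw [Real.sqrt_sq (by norm_num)]]
    exact Real.sqrt_le_sqrt (by norm_num)
  have hc0 : 0 ≤ c := by linarith
  have hcred : c ≤ Real.sqrt (r / (1 + r)) := le_sqrt_ratio hc0 hr0 hcr
  have hbl : 70 / 99 * x + c * y ≤ 1 / 2 := by
    have h1 : 70 / 99 * x ≤ x * Real.sqrt (1 / 2) := by rw [mul_comm]; exact mul_le_mul_of_nonneg_left h70 hx
    have h2 : c * y ≤ y * Real.sqrt (r / (1 + r)) := by rw [mul_comm]; exact mul_le_mul_of_nonneg_left hcred hy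
    linarith
  have hbl' : 70 / 99 * x + 447 / 1000 * y ≤ 1 / 2 := by nlinarith [mul_le_mul_of_nonneg_right hc hy]
  have hP := hpoly hbl
  have hC := first_cond_poly hx hy1 hbl'
  have hden : 0 < 1 - 3 / 4 * y := by linarith
  obtain ⟨σ, hσ_def⟩ : ∃ σ : ℝ, σ = y / (1 - 3 / 4 * y) := ⟨_, rfl⟩
  have hσ0 : 0 ≤ σ := by rw [hσ_def]; exact div_nonneg hy hden.le
  have hσy : σ * (1 - 3 / 4 * y) = y := by rw [hσ_def, div_mul_cancel₀ _ hden.ne']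
  -- the defect coefficient on the interval
  have hcoef : 3 * r / (1 + r) ^ 2 ≤ E := by
    rw [div_le_iff₀ (by positivity)]
    have h1 : 0 ≤ R - r := by linarith
    have h2 : 0 ≤ 3 - E * (2 + r + R) := by nlinarith
    nlinarith [mul_nonneg h1 h2]
  have hcoef0 : 0 ≤ 3 * r / (1 + r) ^ 2 := by positivity
  rw [← hσ_def]
  obtain ⟨κ, hκ_def⟩ : ∃ κ : ℝ, κ = 3 * r / (1 + r) ^ 2 := ⟨_, rfl⟩
  rw [← hκ_def] at hcoef hcoef0 ⊢
  have he : κ * σ ≤ E * σ := mul_le_mul_of_nonneg_right hcoef hσ0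
  have hEσ : E * σ ≤ 3 / 4 * σ := mul_le_mul_of_nonneg_right hE1 hσ0
  -- condition: x(3/4 + (3/4)σ) < 1 from first_cond_poly (divide by 1 - 3y/4)
  have hcondσ : x * (3 / 4 + 3 / 4 * σ) < 1 := by
    have e1 : x * (3 / 4 + 3 / 4 * σ) * (1 - 3 / 4 * y) = x * (3 / 4 * (1 - 3 / 4 * y) + 3 / 4 * y) := by
      linear_combination (3 / 4 * x) * hσy
    have h1 : x * (3 / 4 + 3 / 4 * σ) * (1 - 3 / 4 * y) < 1 * (1 - 3 / 4 * y) := by rw [e1, one_mul]; exact hC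
    exact lt_of_mul_lt_mul_right h1 hden.le
  refine ⟨by have := mul_le_mul_of_nonneg_left (he.trans hEσ) hx; linarith, ?_⟩
  -- landing: the polynomial in σ-form
  have hxy2 : 0 < 2 - x - S * y := by
    have h1 : x * (70 / 99) ≤ 1 / 2 := by nlinarith [mul_nonneg hc0 hy]
    have h2 : S * y ≤ 1 * (71 / 100) := mul_le_mul hS1 hy1 hy zero_le_one
    linarith
  have hPσ : (σ * R * (1 + x / 4) + x * (1 + E * σ)) * (2 - x - S * y) ≤ 4 * (x + S * y) * (1 - x * (3 / 4 + E * σ)) := by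
    have e1 : (σ * R * (1 + x / 4) + x * (1 + E * σ)) * (2 - x - S * y) * (1 - 3 / 4 * y) =
        (y * R * (1 + x / 4) + x * ((1 - 3 / 4 * y) + E * y)) * (2 - x - S * y) := by
      have h1 : σ * R * (1 + x / 4) * (1 - 3 / 4 * y) = y * R * (1 + x / 4) := by
        calc σ * R * (1 + x / 4) * (1 - 3 / 4 * y) = σ * (1 - 3 / 4 * y) * (R * (1 + x / 4)) := by ring
          _ = y * R * (1 + x / 4) := by rw [hσy]; ring
      have h2 : x * (1 + E * σ) * (1 - 3 / 4 * y) = x * ((1 - 3 / 4 * y) + E * y) := by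
        calc x * (1 + E * σ) * (1 - 3 / 4 * y) = x * ((1 - 3 / 4 * y) + E * (σ * (1 - 3 / 4 * y))) := by ring
          _ = x * ((1 - 3 / 4 * y) + E * y) := by rw [hσy]
      linear_combination (2 - x - S * y) * (h1 + h2)
    have e2 : 4 * (x + S * y) * (1 - x * (3 / 4 + E * σ)) * (1 - 3 / 4 * y) = 4 * (x + S * y) * ((1 - 3 / 4 * y) * (1 - 3 / 4 * x) - E * y * x) := by
      have h3 : x * (3 / 4 + E * σ) * (1 - 3 / 4 * y) = x * (3 / 4 * (1 - 3 / 4 * y) + E * y) := by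
        calc x * (3 / 4 + E * σ) * (1 - 3 / 4 * y) = x * (3 / 4 * (1 - 3 / 4 * y) + E * (σ * (1 - 3 / 4 * y))) := by ring
          _ = x * (3 / 4 * (1 - 3 / 4 * y) + E * y) := by rw [hσy]
      linear_combination (-4 * (x + S * y)) * h3
    have := hP
    rw [← e1, ← e2] at this
    exact le_of_mul_le_mul_right this hden
  -- √r ≥ S and the hyperbola at the larger argument
  have hsq : S ≤ Real.sqrt r := by
    rw [show S = Real.sqrt (S ^ 2) by rw [Real.sqrt_sq hS]]; exact Real.sqrt_le_sqrt hSr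
  have hsq1 : Real.sqrt r ≤ 1 := by rw [show (1:ℝ) = Real.sqrt 1 by simp]; exact Real.sqrt_le_sqrt hr1
  have hx71 : x ≤ 71 / 100 := by nlinarith [mul_nonneg hc0 hy]
  have hZle : x + Real.sqrt r * y < 2 := by nlinarith [mul_le_mul hsq1 hy1 hy zero_le_one]
  have hF : 4 * (x + S * y) / (2 - x - S * y) ≤ 4 * (x + Real.sqrt r * y) / (2 - (x + Real.sqrt r * y)) := by
    rw [show 2 - x - S * y = 2 - (x + S * y) by ring]
    exact hyperbola_mono (by nlinarith [mul_le_mul_of_nonneg_right hsq hy]) hZle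
  have hfac0 : 0 ≤ 1 - x * (3 / 4 + E * σ) := by
    have := mul_le_mul_of_nonneg_left hEσ hx; linarith
  have hfac1 : 1 - x * (3 / 4 + E * σ) ≤ 1 - x * (3 / 4 + κ * σ) := by
    have := mul_le_mul_of_nonneg_left he hx; linarith
  have hF0 : 0 ≤ 4 * (x + Real.sqrt r * y) / (2 - (x + Real.sqrt r * y)) := div_nonneg (by positivity) (by linarith)
  calc σ * r * (1 + x / 4) + x * (1 + κ * σ)
      ≤ σ * R * (1 + x / 4) + x * (1 + E * σ) := by
        have h1 : σ * r * (1 + x / 4) ≤ σ * R * (1 + x / 4) :=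
          mul_le_mul_of_nonneg_right (mul_le_mul_of_nonneg_left hrR hσ0) (by linarith)
        have h2 := mul_le_mul_of_nonneg_left he hx
        linarith
    _ ≤ 4 * (x + S * y) / (2 - x - S * y) * (1 - x * (3 / 4 + E * σ)) := by
        rw [div_mul_eq_mul_div, le_div_iff₀ hxy2]
        calc (σ * R * (1 + x / 4) + x * (1 + E * σ)) * (2 - x - S * y)
            ≤ 4 * (x + S * y) * (1 - x * (3 / 4 + E * σ)) := hPσ
          _ = 4 * (x + S * y) * (1 - x * (3 / 4 + E * σ)) := rfl
    _ ≤ 4 * (x + Real.sqrt r * y) / (2 - (x + Real.sqrt r * y)) * (1 - x * (3 / 4 + E * σ)) := mul_le_mul_of_nonneg_right hF hfac0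
    _ ≤ 4 * (x + Real.sqrt r * y) / (2 - (x + Real.sqrt r * y)) * (1 - x * (3 / 4 + κ * σ)) :=
        mul_le_mul_of_nonneg_left hfac1 hF0

/-- **THE FREE FIRST STEP.**  From the exact youngest state — load `y ∈ [0, 71∕100]`, `λ₀ = σ₀ = y∕(1 − 3y∕4)`, `μ₀ = 3σ₀∕4` — a step to an age `k` of ANY
ratio `r = k⁻∕k ∈ [1∕4, 1]` with load `x ≥ 0` under the crude budget line `x√(1∕2) + y√(r∕(1+r)) ≤ 1∕2` satisfies, with the one-step defect bound
`e = a·μ₀ = 3rσ₀∕(1+r)²` ((E65c)): the chain CONDITION `x(e + 3∕4) < 1` and the LANDING `σ₀r(1 + x∕4) + x(1 + e) ≤ F(x + √r·y)·(1 − x(3∕4 + e))`,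
`F(Z) = 4Z∕(2 − Z)` — i.e. the λ-recursion holds with the hyperbolic value `λ_k = F(Z_k)` of (E66b).  Six ratio intervals, §1. [folklore] -/
theorem first_step_free {x y r : ℝ} (hx : 0 ≤ x) (hy : 0 ≤ y) (hy1 : y ≤ 71 / 100) (hr : 1 / 4 ≤ r) (hr1 : r ≤ 1)
    (hb : x * Real.sqrt (1 / 2) + y * Real.sqrt (r / (1 + r)) ≤ 1 / 2) :
    x * (3 * r / (1 + r) ^ 2 * (y / (1 - 3 / 4 * y)) + 3 / 4) < 1 ∧
    y / (1 - 3 / 4 * y) * r * (1 + x / 4) + x * (1 + 3 * r / (1 + r) ^ 2 * (y / (1 - 3 / 4 * y))) ≤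
      4 * (x + Real.sqrt r * y) / (2 - (x + Real.sqrt r * y)) * (1 - x * (3 / 4 + 3 * r / (1 + r) ^ 2 * (y / (1 - 3 / 4 * y)))) := by
  have hr0 : 0 ≤ r := by linarith
  rcases le_or_gt r (729 / 2500) with h1 | h1
  · exact first_of_interval (S := 1 / 2) (R := 729 / 2500) (c := 447 / 1000) (E := 1311 / 2500) hx hy hy1 hr0 hr1
      (by norm_num) (by norm_num) (by nlinarith) h1 (by norm_num) (by norm_num) (by nlinarith) (by norm_num) (by norm_num) hb
      (fun h => first_poly_1 hx hy hy1 h)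
  rcases le_or_gt r (3481 / 10000) with h2 | h2
  · exact first_of_interval (S := 27 / 50) (R := 3481 / 10000) (c := 19 / 40) (E := 5747 / 10000) hx hy hy1 hr0 hr1
      (by norm_num) (by norm_num) (by nlinarith) h2 (by norm_num) (by norm_num) (by nlinarith) (by norm_num) (by norm_num) hb
      (fun h => first_poly_2 hx hy hy1 h)
  rcases le_or_gt r (169 / 400) with h3 | h3
  · exact first_of_interval (S := 59 / 100) (R := 169 / 400) (c := 127 / 250) (E := 783 / 1250) hx hy hy1 hr0 hr1
      (by norm_num) (by norm_num) (by nlinarith) h3 (by norm_num) (by norm_num) (by nlinarith) (by norm_num) (by norm_num) hb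
      (fun h => first_poly_3 hx hy hy1 h)
  rcases le_or_gt r (1369 / 2500) with h4 | h4
  · exact first_of_interval (S := 13 / 20) (R := 1369 / 2500) (c := 68 / 125) (E := 343 / 500) hx hy hy1 hr0 hr1
      (by norm_num) (by norm_num) (by nlinarith) h4 (by norm_num) (by norm_num) (by nlinarith) (by norm_num) (by norm_num) hb
      (fun h => first_poly_4 hx hy hy1 h)
  rcases le_or_gt r (1849 / 2500) with h5 | h5
  · exact first_of_interval (S := 37 / 50) (R := 1849 / 2500) (c := 297 / 500) (E := 7333 / 10000) hx hy hy1 hr0 hr1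
      (by norm_num) (by norm_num) (by nlinarith) h5 (by norm_num) (by norm_num) (by nlinarith) (by norm_num) (by norm_num) hb
      (fun h => first_poly_5 hx hy hy1 h)
  · exact first_of_interval (S := 43 / 50) (R := 1) (c := 163 / 250) (E := 3 / 4) hx hy hy1 hr0 hr1
      (by norm_num) (by norm_num) (by nlinarith) hr1 (by norm_num) (by norm_num) (by nlinarith) (by norm_num) (by norm_num) hb
      (fun h => first_poly_6 hx hy hy1 h)

/-- From the data of one ratio interval to the free-last-step condition. -/
theorem last_of_interval {x z r R c : ℝ} (hx : 0 ≤ x) (hz : 0 ≤ z) (hz1 : z ≤ 71 / 100) (hr0 : 0 ≤ r)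
    (hrR : r ≤ R) (hc : 0 ≤ c) (hcr : c ^ 2 * (1 + r) ≤ r)
    (hb : x * Real.sqrt (1 / 2) + z * Real.sqrt (r / (1 + r)) ≤ 1 / 2)
    (hpoly : 70 / 99 * x + c * z ≤ 1 / 2 → x * (3 / 4 * (2 - z) + 8 * R * z) < 2 - z) :
    x * (3 / 4 + 2 * r * (4 * z / (2 - z))) < 1 := by
  have h70 : (70 : ℝ) / 99 ≤ Real.sqrt (1 / 2) := by
    rw [show (70 : ℝ) / 99 = Real.sqrt ((70 / 99) ^ 2) by rw [Real.sqrt_sq (by norm_num)]]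
    exact Real.sqrt_le_sqrt (by norm_num)
  have hcred : c ≤ Real.sqrt (r / (1 + r)) := le_sqrt_ratio hc hr0 hcr
  have hbl : 70 / 99 * x + c * z ≤ 1 / 2 := by
    have h1 : 70 / 99 * x ≤ x * Real.sqrt (1 / 2) := by rw [mul_comm]; exact mul_le_mul_of_nonneg_left h70 hx
    have h2 : c * z ≤ z * Real.sqrt (r / (1 + r)) := by rw [mul_comm]; exact mul_le_mul_of_nonneg_left hcred hz
    linarith
  have hP := hpoly hbl
  have hden : 0 < 2 - z := by linarith
  have h1 : x * (3 / 4 + 2 * r * (4 * z / (2 - z))) ≤ x * (3 / 4 + 8 * R * z / (2 - z)) := by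
    refine mul_le_mul_of_nonneg_left ?_ hx
    rw [show 2 * r * (4 * z / (2 - z)) = 8 * r * z / (2 - z) by ring]
    have : 8 * r * z ≤ 8 * R * z := by nlinarith [mul_nonneg (sub_nonneg.mpr hrR) hz]
    have := div_le_div_of_nonneg_right this hden.le
    linarith
  have h2 : x * (3 / 4 + 8 * R * z / (2 - z)) < 1 := by
    have e1 : x * (3 / 4 + 8 * R * z / (2 - z)) = x * (3 / 4 * (2 - z) + 8 * R * z) / (2 - z) := by
      field_simp
    rw [e1, div_lt_one hden]; exact hP
  exact lt_of_le_of_lt h1 h2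

/-- **THE FREE LAST STEP.**  From the invariant region of (E66b) — `λ_{k⁻} ≤ F(Z) = 4Z∕(2 − Z)`, `Z = Z_{k⁻} ∈ [0, 71∕100]` — a last step of ANY ratio
`r ∈ [1∕4, 1]` with load `x ≥ 0` under the crude budget line `x√(1∕2) + Z√(r∕(1+r)) ≤ 1∕2` satisfies the chain CONDITION with the far-field defect bound
`e = 2rF(Z)`: `x(3∕4 + 2rF(Z)) < 1` (value `≤ 0.93`).  Three ratio intervals, §1. [folklore] -/
theorem last_step_free {x z r : ℝ} (hx : 0 ≤ x) (hz : 0 ≤ z) (hz1 : z ≤ 71 / 100) (hr : 1 / 4 ≤ r) (hr1 : r ≤ 1)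
    (hb : x * Real.sqrt (1 / 2) + z * Real.sqrt (r / (1 + r)) ≤ 1 / 2) :
    x * (3 / 4 + 2 * r * (4 * z / (2 - z))) < 1 := by
  have hr0 : 0 ≤ r := by linarith
  rcases le_or_gt r (9 / 16) with h1 | h1
  · exact last_of_interval (R := 9 / 16) (c := 447 / 1000) hx hz hz1 hr0 h1 (by norm_num) (by nlinarith) hb (fun h => last_poly_1 hz hz1 h)
  rcases le_or_gt r (484 / 625) with h2 | h2
  · exact last_of_interval (R := 484 / 625) (c := 3 / 5) hx hz hz1 hr0 h2 (by norm_num) (by nlinarith) hb (fun h => last_poly_2 hz hz1 h)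
  · exact last_of_interval (R := 1) (c := 33 / 50) hx hz hz1 hr0 hr1 (by norm_num) (by nlinarith) hb (fun h => last_poly_3 hz hz1 h)

end Summit.QuantumFields.BalabanUV.Beta.EriceRemainderEnclosureHistoryAutonomyComparisonTowerFreeSteps

end
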